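import Summits.QuantumFields.YangMills.Theses.FemtoCutoffLadder
import Summits.QuantumFields.YangMills.Theorems.FemtoCutoffLadderLocalWallTopPos

/-!
# Route `FemtoCutoffLadder`, LINE g5-A «one plaquette wall at a time»: the wall-step items need only their COMPARISON clauses

Lead seat `ym-line-fcl-p1` g9 (2026-08-28).  By-name reductions for `LocalWallStep` (stmt-QuantumFields-26282, crux r205; child of
`LargeFieldInsensitivityR` 26197 via the planner's glue p610789), `SingleWallStep` (26631, support: the wall set `Q = ∅` — ATTACK FIRST per critic
idea-crit-4 07:03Z P2) and `LastWallStep` (26638, support: `Q = univ ∖ {p₀}`): each item is «two positivity clauses + two cross-multiplied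
comparisons», and the positivity clauses hold unconditionally for EVERY wall set (`SFCompression.walledTop_pos`,
`Theorems/FemtoCutoffLadderLocalWallTopPos.lean`).  So:
* ★ `localWallStep_of_comparisons` — the two comparisons for every `(Q, p₀ ∉ Q)` (same constants, spelled out) ⟹ `LocalWallStep` BY NAME;
* ★ `singleWallStep_of_comparisons`, ★ `lastWallStep_of_comparisons` — likewise for the two supports.
HONEST FRAMING: bookkeeping; the comparison clauses are OPEN (XL / L–XL: one-defect relative spectral perturbation of the walled femto doublet,
uniform in the wall set; critic P1 «imprint dichotomy»).  R2b1 is a RECORD rung — not infinite volume, not a mass gap, not Clay; no summit is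
proved by this line.  No definitions, no named facts, no `sorry`.
-/

set_option autoImplicit false

noncomputable section

namespace Summit.QuantumFields.YangMills.Theorems.FemtoCutoffLadder

open Literature.MathematicalPhysics.QuantumFieldTheory hiding SU2
open Summit.QuantumFields.YangMills.Theorems.FemtoTransferGap
open Summit.QuantumFields.YangMills.Theses.FemtoCutoffLadder

/-- ★ **`LocalWallStep` from its comparison clauses**: the walled top values are positive for every wall set (`walledTop_pos`), so the two
cross-multiplied one-wall comparisons (uniform in `(Q, p₀)`, slack `e^{A/(β²N)}`) give the item BY NAME. [folklore] -/
theorem localWallStep_of_comparisons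
    (h : ∀ κ : ℝ, 0 < κ → κ < 1 → ∃ (A lam0 : ℝ) (L0 : ℕ), 0 ≤ A ∧ 0 < lam0 ∧ ∀ lam : ℝ, 0 < lam → lam ≤ lam0 → ∀ (L : ℕ) [NeZero L], L0 ≤ L → ∀ β : ℝ, InFemtoWindow lam β L → let W : Set (Plaquette 3 L) → (GaugeConfig 3 L SU2 → ℝ) → Prop := fun Q ψ => ∀ U, (∃ p ∈ Q, β ^ (κ - 1) < 2 - (su2Rep (plaquetteHolonomy U p.1 p.2.1.1 p.2.1.2)).trace.re) → ψ U = 0; let t : Set (Plaquette 3 L) → ℝ := fun Q => sSup (rayleighSet su2Rep L β (W Q)); let s : Set (Plaquette 3 L) → ℝ := fun Q => sInf {x : ℝ | ∃ φ : GaugeConfig 3 L SU2 → ℝ, IsPhys φ ∧ x = sSup (rayleighSet su2Rep L β fun ψ => W Q ψ ∧ l2 ψ φ = 0)}; ∀ (Q : Set (Plaquette 3 L)) (p₀ : Plaquette 3 L), p₀ ∉ Q → s (insert p₀ Q) ^ L * t Q ^ L ≤ Real.exp (A / β ^ 2 / (Fintype.card (Plaquette 3 L) : ℝ)) * (s Q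 ^ L * t (insert p₀ Q) ^ L) ∧ s Q ^ L * t (insert p₀ Q) ^ L ≤ Real.exp (A / β ^ 2 / (Fintype.card (Plaquette 3 L) : ℝ)) * (s (insert p₀ Q) ^ L * t Q ^ L)) :
    LocalWallStep := by
  intro κ hκ hκ1
  obtain ⟨A, lam0, L0, hA, hlam0, H⟩ := h κ hκ hκ1
  refine ⟨A, lam0, L0, hA, hlam0, fun lam hlam hle L _ hL0 β hW => ?_⟩
  have hβ : 0 < β := by linarith [hW.1]
  intro W t s Q p₀ hp₀
  exact ⟨SFCompression.walledTop_pos L hβ κ Q, SFCompression.walledTop_pos L hβ κ (insert p₀ Q),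
    H lam hlam hle L hL0 β hW Q p₀ hp₀⟩

/-- ★ **`SingleWallStep` (the wall set `Q = ∅`) from its comparison clauses.** [folklore] -/
theorem singleWallStep_of_comparisons
    (h : ∀ κ : ℝ, 0 < κ → κ < 1 → ∃ (A lam0 : ℝ) (L0 : ℕ), 0 ≤ A ∧ 0 < lam0 ∧ ∀ lam : ℝ, 0 < lam → lam ≤ lam0 → ∀ (L : ℕ) [NeZero L], L0 ≤ L → ∀ β : ℝ, InFemtoWindow lam β L → let W : Set (Plaquette 3 L) → (GaugeConfig 3 L SU2 → ℝ) → Prop := fun Q ψ => ∀ U, (∃ p ∈ Q, β ^ (κ - 1) < 2 - (su2Rep (plaquetteHolonomy U p.1 p.2.1.1 p.2.1.2)).trace.re) → ψ U = 0; let t : Set (Plaquette 3 L) → ℝ := fun Q => sSup (rayleighSet su2Rep L β (W Q)); let s : Set (Plaquette 3 L) → ℝ := fun Q => sInf {x : ℝ | ∃ φ : GaugeConfig 3 L SU2 → ℝ, IsPhys φ ∧ x = sSup (rayleighSet su2Rep L β fun ψ => W Q ψ ∧ l2 ψ φ = 0)}; ∀ p₀ : Plaquette 3 L, s ((insert p₀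 (∅ : Set (Plaquette 3 L)))) ^ L * t (∅ : Set (Plaquette 3 L)) ^ L ≤ Real.exp (A / β ^ 2 / (Fintype.card (Plaquette 3 L) : ℝ)) * (s (∅ : Set (Plaquette 3 L)) ^ L * t ((insert p₀ (∅ : Set (Plaquette 3 L)))) ^ L) ∧ s (∅ : Set (Plaquette 3 L)) ^ L * t ((insert p₀ (∅ : Set (Plaquette 3 L)))) ^ L ≤ Real.exp (A / β ^ 2 / (Fintype.card (Plaquette 3 L) : ℝ)) * (s ((insert p₀ (∅ : Set (Plaquette 3 L)))) ^ L * t (∅ : Set (Plaquette 3 L)) ^ L)) :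
    SingleWallStep := by
  intro κ hκ hκ1
  obtain ⟨A, lam0, L0, hA, hlam0, H⟩ := h κ hκ hκ1
  refine ⟨A, lam0, L0, hA, hlam0, fun lam hlam hle L _ hL0 β hW => ?_⟩
  have hβ : 0 < β := by linarith [hW.1]
  intro W t s p₀
  exact ⟨SFCompression.walledTop_pos L hβ κ _, SFCompression.walledTop_pos L hβ κ _, H lam hlam hle L hL0 β hW p₀⟩

/-- ★ **`LastWallStep` (the wall set `Q = univ ∖ {p₀}`) from its comparison clauses.** [folklore] -/
theorem lastWallStep_of_comparisons
    (h : ∀ κ : ℝ, 0 < κ → κ < 1 → ∃ (A lam0 : ℝ) (L0 : ℕ), 0 ≤ A ∧ 0 < lam0 ∧ ∀ lam : ℝ, 0 < lam → lam ≤ lam0 → ∀ (L : ℕ) [NeZero L], L0 ≤ L → ∀ β : ℝ, InFemtoWindow lam β L → let W : Set (Plaquette 3 L) → (GaugeConfig 3 L SU2 → ℝ) → Prop := fun Q ψ => ∀ U, (∃ p ∈ Q, β ^ (κ - 1) < 2 - (su2Rep (plaquetteHolonomy U p.1 p.2.1.1 p.2.1.2)).trace.re) → ψ U = 0; let t : Set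 (Plaquette 3 L) → ℝ := fun Q => sSup (rayleighSet su2Rep L β (W Q)); let s : Set (Plaquette 3 L) → ℝ := fun Q => sInf {x : ℝ | ∃ φ : GaugeConfig 3 L SU2 → ℝ, IsPhys φ ∧ x = sSup (rayleighSet su2Rep L β fun ψ => W Q ψ ∧ l2 ψ φ = 0)}; ∀ p₀ : Plaquette 3 L, s ((insert p₀ ((Set.univ : Set (Plaquette 3 L)) \ {p₀}))) ^ L * t ((Set.univ : Set (Plaquette 3 L)) \ {p₀}) ^ L ≤ Real.exp (A / β ^ 2 / (Fintype.card (Plaquette 3 L) : ℝ)) * (s ((Set.univ : Set (Plaquette 3 L)) \ {p₀}) ^ L * t ((insert p₀ ((Set.univ : Set (Plaquette 3 L)) \ {p₀}))) ^ L) ∧ s ((Set.univ : Set (Plaquette 3 L)) \ {p₀}) ^ L * t ((insert p₀ ((Set.univ : Set (Plaquette 3 L)) \ {p₀}))) ^ L ≤ Real.exp (A / β ^ 2 / (Fintype.card (Plaquette 3 L) : ℝ)) * (s ((insert p₀ ((Set.univ : Set (Plaquette 3 L)) \ {p₀}))) ^ L * t ((Set.univ : Set (Plaquette 3 L)) \ {p₀})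 ^ L)) :
    LastWallStep := by
  intro κ hκ hκ1
  obtain ⟨A, lam0, L0, hA, hlam0, H⟩ := h κ hκ hκ1
  refine ⟨A, lam0, L0, hA, hlam0, fun lam hlam hle L _ hL0 β hW => ?_⟩
  have hβ : 0 < β := by linarith [hW.1]
  intro W t s p₀
  exact ⟨SFCompression.walledTop_pos L hβ κ _, SFCompression.walledTop_pos L hβ κ _, H lam hlam hle L hL0 β hW p₀⟩

end Summit.QuantumFields.YangMills.Theorems.FemtoCutoffLadder

end
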